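import Literature.MathematicalPhysics.QuantumFieldTheory.Balaban1983to89.B2Eq228Conditioning

/-!
# B4 (4.16)–(4.17), (4.20)–(4.21): the Gaussian Fourier-transform computation of the constant `A₀`
(abstract finite-dimensional form)

T. Bałaban, *Regularity and decay of lattice Green's functions*, Commun. Math. Phys. **89** (1983) 571–597
[Balaban1983RegularityDecay] (= B4), §4, p. 592 [PDF 22] (journal page = PDF page + 570; renders
`run/shared/lean/pub/pub-balaban/b2b-balaban-ref1/pages/1983-cmp89-regularity-decay/…-p022-x2.png`).  Unit
lit-balaban-r01 gen 4 (reader/typer of block B4; row B4.Eq4.14 of `lit-balaban-r01/ROWS-B4.md`); statement-level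
skeleton of published theorems with citation tags; proofs where landed; nothing here is a claim about the Yang–Mills
mass gap.

## The printed passage (p. 592, verbatim from the ×2 render)

After the translations turning (4.15) into (4.16) — *"∫dφ|_{Δ(x,x′)} exp[−½a_k|(Q_kφ)(x)|² − ½⟨φ,(−Δ^{η,N}_Δ)φ⟩ −
½a_k|(Q_kφ)(x′)|² − ½⟨φ,(−Δ^{η,N}_{Δ′})φ⟩ − ½Σ_{b∈B(⟨x,x′⟩)} η^d|(∂^ηφ)(b) + η^{−1}ψ|²] = const exp(−½A₀|ψ|²), (4.16)
… Now we have to show that A₀ > 0, more exactly A₀ ≥ γ₀″, γ₀″ > 0, and γ₀″ depends on d and a only. It is obvious that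
the integral on the left hand side and the function on the right hand side of (4.16) factorizes into the products of
the corresponding expressions for the components of φ and ψ. We can assume that φ and ψ are real quantities. We will
use the following simple formula for the Fourier transform of the Gaussian function:
∫dψ exp(−iξψ) exp(−½A₀ψ²) = √(2πA₀^{−1}) exp(−½A₀^{−1}ξ²). (4.17)
Now it is sufficient to prove that 0 < A₀^{−1} ≤ γ₀″^{−1}, and γ₀″^{−1} depends on d and a only. Let us calculate the
Fourier transform of the integral on the left hand side of (4.16)."*  After (4.18) (completing the square in `ψ`)
and the notation `⟨φ,Aφ⟩` (4.19): *"The Fourier transform with respect to ψ of the expression on the left hand side of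
(4.16) can be written in the form
∫dψ exp(−iξψ)∫dφ exp[−½η^{−1}|ψ + Σ_{b∈B(⟨x,x′⟩)} η^{d−1}(φ(b₊) − φ(b₋))|² − ½⟨φ,Aφ⟩]
 = ∫dψ exp(−iξψ) exp(−½η^{−1}ψ²)∫dφ exp iξ Σ_{b∈B(⟨x,x′⟩)} η^{d−1}(φ(b₊) − φ(b₋)) · exp(−½⟨φ,Aφ⟩)
 = √(2πη) exp(−½ηξ²)(2π)^{L^kd}(det A)^{−1/2} exp(−½⟨f_{⟨x,x′⟩}, A^{−1}f_{⟨x,x′⟩}⟩ξ²), (4.20)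
and we get the formula for A₀^{−1}:  A₀^{−1} = η + ⟨f_{⟨x,x′⟩}, A^{−1}f_{⟨x,x′⟩}⟩, (4.21)"*.

## Typing (abstract and exact; plain coordinates)

Here the computation is carried out for an ARBITRARY positive definite symmetric matrix `M` on a finite index set
`n` (the form `⟨φ,Aφ⟩` of (4.19) in plain coordinates), an arbitrary vector `f : n → ℝ` (the functional
`φ ↦ Σ_b η^{d−1}(φ(b₊) − φ(b₋)) = ⟨f_{⟨x,x′⟩},φ⟩`) and a coupling `a > 0` (= `η^{−1}`); the concrete two-block
instance (the form (4.19), (4.18), (4.22)) is the business of the block model of `B4Ineq422`.  `dφ` = Lebesgue measure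
`volume` on `n → ℝ`; `gaussWeight`/`gaussInt`/`gaussNorm` are the tree's (`B13GaugeDevices`, `B2Eq228Conditioning`:
`gaussNorm M = ∫dφ e^{−½φ⬝Mφ} = √(2π)^{|n|}/√(det M)` — the print's `(2π)^{L^kd}(det A)^{−1/2}` with `|n| = 2L^{kd}`
real variables).

## What is proved (kernel-checked, 0 sorry; theorems only — no definition, no named fact)

* §1 **(4.17)** `eq417`: `∫dψ e^{−iξψ}e^{−½A₀ψ²} = √(2πA₀⁻¹)e^{−½A₀⁻¹ξ²}` (Mathlib `integral_cexp_quadratic`).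
* §2 the **characteristic function of the centred Gaussian** in Lebesgue form `gaussInt_cexp`:
  `∫dφ e^{−½φ⬝Mφ}e^{iξ⟨t,φ⟩} = gaussNorm(M)·e^{−½ξ²⟨t,M⁻¹t⟩}` — the `φ`-integral of the middle member of (4.20) —
  from Mathlib's `charFun_multivariateGaussian` through the tree's bridge `gaussProb_eq_map_multivariateGaussian`.
* §3 the rank-one algebra behind (4.21) (`rankOne_inv_mulVec`, `det_add_rankOne`, `gaussNorm_add_rankOne`),
  **(4.21)** `eq421`: `a − a²⟨f,(M + a f fᵀ)⁻¹f⟩ = (a⁻¹ + ⟨f,M⁻¹f⟩)⁻¹ =: A₀` (`a0_pos`: `A₀ > 0`), and **(4.16)**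
  `eq416`: `∫dφ exp[−½a(ψ + ⟨f,φ⟩)² − ½φ⬝Mφ] = gaussNorm(M + a f fᵀ)·exp(−½A₀ψ²)` with **`A₀⁻¹ = a⁻¹ + ⟨f, M⁻¹f⟩`**,
  by the tree's linear-shift formula (`B2Eq228Conditioning.integral_tilt`) — the real-variable content of
  (4.16)–(4.21).
* §4 **(4.20)** `eq420` (first member = last member: the Fourier transform in `ψ` of the left side of (4.16), from
  `eq416` + `eq417` + the matrix determinant lemma) and `eq420_mid` (middle member = last member, from `eq417` at
  `A₀ = a` and `gaussInt_cexp`) — so all three members of (4.20) agree, WITHOUT the interchange of the `ψ`- and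
  `φ`-integrations used in print for the first equality.
-/

namespace Literature.MathematicalPhysics.QuantumFieldTheory.Balaban1983to89.B4Eq417GaussFourier

open MeasureTheory Matrix Complex ProbabilityTheory
open Literature.MathematicalPhysics.QuantumFieldTheory.Balaban1983to89.B13GaugeDevices
open Literature.MathematicalPhysics.QuantumFieldTheory.Balaban1983to89.B2Eq228Conditioning

noncomputable section

variable {n : Type} [Fintype n] [DecidableEq n]

/-! ## §1. (4.17): the Fourier transform of the one-dimensional Gaussian -/

/-- **(4.17)** *"∫dψ exp(−iξψ) exp(−½A₀ψ²) = √(2πA₀^{−1}) exp(−½A₀^{−1}ξ²)"* for `A₀ > 0`.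
[cite: Balaban1983RegularityDecay, (4.17) p.592] -/
theorem eq417 {A₀ : ℝ} (hA : 0 < A₀) (ξ : ℝ) :
    ∫ ψ : ℝ, cexp (-(I * ξ * ψ)) * cexp (-((A₀ / 2 : ℝ) : ℂ) * (ψ : ℂ) ^ 2)
      = ((Real.sqrt (2 * Real.pi * A₀⁻¹) * Real.exp (-(1 / 2) * A₀⁻¹ * ξ ^ 2) : ℝ) : ℂ) := by
  have hb : (-((A₀ / 2 : ℝ) : ℂ)).re < 0 := by
    rw [neg_re, ofReal_re]; linarith
  have h := integral_cexp_quadratic hb (-(I * ξ)) 0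
  have e1 : ∀ ψ : ℝ, cexp (-(I * ξ * ψ)) * cexp (-((A₀ / 2 : ℝ) : ℂ) * (ψ : ℂ) ^ 2)
      = cexp (-((A₀ / 2 : ℝ) : ℂ) * (ψ : ℂ) ^ 2 + -(I * ξ) * ψ + 0) := by
    intro ψ; rw [← Complex.exp_add]; congr 1; ring
  simp_rw [e1]
  rw [h]
  have e2 : (Real.pi : ℂ) / -(-((A₀ / 2 : ℝ) : ℂ)) = ((2 * Real.pi * A₀⁻¹ : ℝ) : ℂ) := by
    push_cast
    field_simp
  have e3 : (0 : ℂ) - (-(I * ξ)) ^ 2 / (4 * -((A₀ / 2 : ℝ) : ℂ)) = ((-(1 / 2) * A₀⁻¹ * ξ ^ 2 : ℝ) : ℂ) := by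
    push_cast
    have hA' : (A₀ : ℂ) ≠ 0 := by exact_mod_cast hA.ne'
    field_simp
    rw [I_sq]
    ring
  rw [e2, e3, show (1 / 2 : ℂ) = ((1 / 2 : ℝ) : ℂ) by push_cast; ring, ← ofReal_cpow (by positivity),
    ← Real.sqrt_eq_rpow, ← ofReal_exp, ← ofReal_mul]

/-! ## §2. The `φ`-integral of (4.20): the characteristic function of the centred Gaussian `e^{−½φ⬝Mφ}dφ` -/

omit [DecidableEq n] in
/-- Complex-valued (or vector-valued) integrals against the probabilistic Gaussian measure `dμ_{M⁻¹}` of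
`B2Eq228Conditioning` are normalised Gaussian integrals: `∫G dμ_{M⁻¹} = [∫dφ e^{−½φ⬝Mφ}]⁻¹∫dφ e^{−½φ⬝Mφ}G(φ)`
(the tree's `integral_gaussProb`, for a general Banach-space-valued integrand). [folklore] -/
private theorem integral_gaussProb_smul {E : Type*} [NormedAddCommGroup E] [NormedSpace ℝ E] (M : Matrix n n ℝ)
    (G : (n → ℝ) → E) : ∫ x, G x ∂(gaussProb M) = (gaussNorm M)⁻¹ • gaussInt M G := by
  have hm : Measurable fun x : n → ℝ => ENNReal.ofReal (gaussWeight M x) :=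
    (measurable_gaussWeight_real M).ennreal_ofReal
  rw [gaussProb, integral_smul_measure, integral_withDensity_eq_integral_toReal_smul hm
    (Filter.Eventually.of_forall fun _ => ENNReal.ofReal_lt_top)]
  rw [ENNReal.toReal_ofReal (inv_nonneg.2 (gaussNorm_nonneg M))]
  simp only [gaussInt]
  congr 1
  refine integral_congr_ae (Filter.Eventually.of_forall fun x => ?_)
  simp only [ENNReal.toReal_ofReal (gaussWeight_pos M x).le]

/-- **The `φ`-integral in the middle member of (4.20)** — the characteristic function of the centred Gaussian with
covariance `M⁻¹`, in Lebesgue form: `∫dφ e^{−½φ⬝Mφ} e^{i⟨t,φ⟩} = [∫dφ e^{−½φ⬝Mφ}]·e^{−½⟨t,M⁻¹t⟩}` for `M` positive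
definite (print, with `t = ξf_{⟨x,x′⟩}`: *"∫dφ exp iξΣ_bη^{d−1}(φ(b₊) − φ(b₋)) · exp(−½⟨φ,Aφ⟩) = (2π)^{L^kd}(det
A)^{−1/2}exp(−½⟨f,A^{−1}f⟩ξ²)"*).  From Mathlib's `charFun_multivariateGaussian` through the tree's identification
`gaussProb_eq_map_multivariateGaussian` of `dμ_{M⁻¹}` with `multivariateGaussian 0 M⁻¹`.
[cite: Balaban1983RegularityDecay, (4.20) p.592] -/
theorem gaussInt_cexp {M : Matrix n n ℝ} (hM : M.PosDef) (t : n → ℝ) :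
    gaussInt M (fun x => cexp (((t ⬝ᵥ x : ℝ) : ℂ) * I))
      = (gaussNorm M : ℂ) * cexp (-((t ⬝ᵥ (M⁻¹ *ᵥ t) / 2 : ℝ) : ℂ)) := by
  have hS : (M⁻¹).PosSemidef := hM.posSemidef.inv
  have hcf := charFun_multivariateGaussian (μ := (0 : EuclideanSpace ℝ n)) hS (WithLp.toLp 2 t)
  rw [inner_zero_right, WithLp.ofLp_toLp] at hcf
  simp only [ofReal_zero, zero_mul, zero_sub] at hcf
  have h1 : charFun (multivariateGaussian 0 M⁻¹) (WithLp.toLp 2 t)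
      = ∫ x, cexp (((t ⬝ᵥ x : ℝ) : ℂ) * I) ∂(gaussProb M) := by
    rw [charFun_apply, gaussProb_eq_map_multivariateGaussian hM, integral_map_equiv]
    refine integral_congr_ae (Filter.Eventually.of_forall fun v => ?_)
    simp only [MeasurableEquiv.toLp_symm_apply, EuclideanSpace.inner_eq_star_dotProduct, star_trivial]
  rw [h1, integral_gaussProb_smul, inv_smul_eq_iff₀ (gaussNorm_pos hM).ne', Complex.real_smul] at hcf
  rw [hcf]
  congr 2
  push_cast
  ring

/-! ## §3. (4.16) and (4.21): completing the square in `φ` — the rank-one algebra of `M + a f fᵀ` -/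

omit [DecidableEq n] in
/-- `(f fᵀ)v = ⟨f,v⟩f`. [folklore] -/
private theorem vecMulVec_mulVec_self (f v : n → ℝ) : vecMulVec f f *ᵥ v = (f ⬝ᵥ v) • f := by
  ext i
  simp only [mulVec, dotProduct, vecMulVec_apply, Pi.smul_apply, smul_eq_mul, Finset.sum_mul]
  exact Finset.sum_congr rfl (fun j _ => by ring)

omit [DecidableEq n] in
/-- `φ⬝(f fᵀ)φ = ⟨f,φ⟩²`. [folklore] -/
private theorem dotProduct_vecMulVec_mulVec (f v : n → ℝ) : v ⬝ᵥ (vecMulVec f f *ᵥ v) = (f ⬝ᵥ v) ^ 2 := by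
  rw [vecMulVec_mulVec_self, dotProduct_smul, smul_eq_mul, dotProduct_comm v f, sq]

omit [DecidableEq n] in
/-- `M + a f fᵀ` is positive definite for `M` positive definite and `a ≥ 0` (the matrix of the exponent of (4.16)
after completing the square). [cite: Balaban1983RegularityDecay, (4.16) p.592] -/
theorem rankOne_posDef {M : Matrix n n ℝ} (hM : M.PosDef) {a : ℝ} (ha : 0 ≤ a) (f : n → ℝ) :
    (M + a • vecMulVec f f).PosDef := by
  have h : (vecMulVec f f).PosSemidef := by
    simpa only [star_trivial] using posSemidef_vecMulVec_self_star f
  exact hM.add_posSemidef (h.smul ha)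

/-- `(M + a f fᵀ)(M⁻¹f) = (1 + a⟨f,M⁻¹f⟩)f` — the rank-one algebra behind (4.21).
[cite: Balaban1983RegularityDecay, (4.21) p.592] -/
theorem rankOne_mulVec_inv_mulVec {M : Matrix n n ℝ} (hdet : IsUnit M.det) (a : ℝ) (f : n → ℝ) :
    (M + a • vecMulVec f f) *ᵥ (M⁻¹ *ᵥ f) = (1 + a * (f ⬝ᵥ (M⁻¹ *ᵥ f))) • f := by
  rw [add_mulVec, smul_mulVec, mulVec_mulVec, mul_nonsing_inv _ hdet, one_mulVec,
    vecMulVec_mulVec_self, smul_smul, add_smul, one_smul]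

/-- `(M + a f fᵀ)⁻¹f = (1 + a⟨f,M⁻¹f⟩)⁻¹M⁻¹f` (`M` positive definite, `a ≥ 0`) — the rank-one algebra behind
(4.21). [cite: Balaban1983RegularityDecay, (4.21) p.592] -/
theorem rankOne_inv_mulVec {M : Matrix n n ℝ} (hM : M.PosDef) {a : ℝ} (ha : 0 ≤ a) (f : n → ℝ) :
    (M + a • vecMulVec f f)⁻¹ *ᵥ f = (1 + a * (f ⬝ᵥ (M⁻¹ *ᵥ f)))⁻¹ • (M⁻¹ *ᵥ f) := by
  have hdet : IsUnit M.det := isUnit_iff_ne_zero.2 hM.det_pos.ne'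
  have hNdet : IsUnit (M + a • vecMulVec f f).det := isUnit_iff_ne_zero.2 (rankOne_posDef hM ha f).det_pos.ne'
  have hs : 0 < 1 + a * (f ⬝ᵥ (M⁻¹ *ᵥ f)) := by
    have : 0 ≤ f ⬝ᵥ (M⁻¹ *ᵥ f) := by
      simpa only [star_trivial] using hM.posSemidef.inv.dotProduct_mulVec_nonneg f
    nlinarith [mul_nonneg ha this]
  have h := congrArg (fun v => (M + a • vecMulVec f f)⁻¹ *ᵥ v) (rankOne_mulVec_inv_mulVec hdet a f)
  rw [mulVec_mulVec, nonsing_inv_mul _ hNdet, one_mulVec, mulVec_smul] at h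
  have h2 := congrArg (fun v => (1 + a * (f ⬝ᵥ (M⁻¹ *ᵥ f)))⁻¹ • v) h
  simp only [smul_smul, inv_mul_cancel₀ hs.ne', one_smul] at h2
  exact h2.symm

/-- *"Of course both terms on the right side of (4.21) are ≧ 0"* — and `a⁻¹ = η > 0`, so the constant
`A₀ = (a⁻¹ + ⟨f, M⁻¹f⟩)⁻¹` of (4.16)/(4.21) is positive. [cite: Balaban1983RegularityDecay, p.592 (after (4.21))] -/
theorem a0_pos {M : Matrix n n ℝ} (hM : M.PosDef) {a : ℝ} (ha : 0 < a) (f : n → ℝ) :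
    0 < (a⁻¹ + f ⬝ᵥ (M⁻¹ *ᵥ f))⁻¹ := by
  have : 0 ≤ f ⬝ᵥ (M⁻¹ *ᵥ f) := by
    simpa only [star_trivial] using hM.posSemidef.inv.dotProduct_mulVec_nonneg f
  exact inv_pos.2 (by positivity)

/-- **(4.21)**: the constant produced by the Gaussian integration of (4.16) is `A₀ = a − a²⟨f,(M + a f fᵀ)⁻¹f⟩ =
(a⁻¹ + ⟨f,M⁻¹f⟩)⁻¹`, i.e. *"A₀^{−1} = η + ⟨f_{⟨x,x′⟩}, A^{−1}f_{⟨x,x′⟩}⟩, (4.21)"* (`a⁻¹ = η`, `M` = the form `A`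
of (4.19) in plain coordinates). [cite: Balaban1983RegularityDecay, (4.21) p.592] -/
theorem eq421 {M : Matrix n n ℝ} (hM : M.PosDef) {a : ℝ} (ha : 0 < a) (f : n → ℝ) :
    a - a ^ 2 * (f ⬝ᵥ ((M + a • vecMulVec f f)⁻¹ *ᵥ f)) = (a⁻¹ + f ⬝ᵥ (M⁻¹ *ᵥ f))⁻¹ := by
  set s := f ⬝ᵥ (M⁻¹ *ᵥ f) with hs
  have hs0 : 0 ≤ s := by
    simpa only [star_trivial] using hM.posSemidef.inv.dotProduct_mulVec_nonneg f
  rw [rankOne_inv_mulVec hM ha.le, dotProduct_smul, smul_eq_mul, ← hs]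
  have h1 : 0 < 1 + a * s := by nlinarith [mul_nonneg ha.le hs0]
  field_simp
  ring

/-- **(4.16) with (4.21)** (abstract form, plain coordinates): for `M` positive definite, `a > 0` and any `f`,
`∫dφ exp[−½a(ψ + ⟨f,φ⟩)² − ½φ⬝Mφ] = const·exp(−½A₀ψ²)` with `const = ∫dφ e^{−½φ⬝(M + a f fᵀ)φ}` and
`A₀ = (a⁻¹ + ⟨f,M⁻¹f⟩)⁻¹` (`eq421`) — print: *"… = const exp(−½A₀|ψ|²), (4.16)"*, *"A₀^{−1} = η + ⟨f_{⟨x,x′⟩},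
A^{−1}f_{⟨x,x′⟩}⟩ (4.21)"*; by the tree's linear-shift formula `B2Eq228Conditioning.integral_tilt` (completing the
square in `φ`; the print obtains `A₀` through the Fourier transform (4.17)–(4.20), see §4).
[cite: Balaban1983RegularityDecay, (4.16), (4.21) p.592] -/
theorem eq416 {M : Matrix n n ℝ} (hM : M.PosDef) {a : ℝ} (ha : 0 < a) (f : n → ℝ) (ψ : ℝ) :
    ∫ φ : n → ℝ, Real.exp (-(1 / 2) * (a * (ψ + f ⬝ᵥ φ) ^ 2) - 1 / 2 * (φ ⬝ᵥ (M *ᵥ φ)))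
      = gaussNorm (M + a • vecMulVec f f) * Real.exp (-(1 / 2) * ((a⁻¹ + f ⬝ᵥ (M⁻¹ *ᵥ f))⁻¹ * ψ ^ 2)) := by
  set N := M + a • vecMulVec f f with hN
  have hNpd : N.PosDef := rankOne_posDef hM ha.le f
  have hNs : N.IsSymm := by
    have h := hNpd.isHermitian.eq
    rwa [conjTranspose_eq_transpose_of_trivial] at h
  have hNdet : IsUnit N.det := isUnit_iff_ne_zero.2 hNpd.det_pos.ne'
  have hpt : ∀ φ : n → ℝ, Real.exp (-(1 / 2) * (a * (ψ + f ⬝ᵥ φ) ^ 2) - 1 / 2 * (φ ⬝ᵥ (M *ᵥ φ)))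
      = Real.exp (-(1 / 2) * (a * ψ ^ 2)) *
        (Real.exp (-(((a * ψ) • f) ⬝ᵥ φ) - 1 / 2 * (φ ⬝ᵥ (N *ᵥ φ))) * (1 : ℝ)) := by
    intro φ
    rw [mul_one, ← Real.exp_add]
    congr 1
    rw [hN, add_mulVec, dotProduct_add, smul_mulVec, dotProduct_smul, dotProduct_vecMulVec_mulVec,
      smul_dotProduct, smul_eq_mul, smul_eq_mul]
    ring
  simp_rw [hpt]
  rw [integral_const_mul, integral_tilt N hNs hNdet ((a * ψ) • f) (fun _ => (1 : ℝ))]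
  have hg : gaussInt N (fun _ : n → ℝ => (1 : ℝ)) = gaussNorm N := by
    simp [gaussInt, gaussNorm]
  rw [hg, smul_dotProduct, mulVec_smul, dotProduct_smul, smul_eq_mul, smul_eq_mul]
  have hform := eq421 hM ha f
  rw [← hN] at hform
  rw [← hform]
  have e : Real.exp (-(1 / 2) * (a * ψ ^ 2)) * (Real.exp (1 / 2 * (a * ψ * (a * ψ * (f ⬝ᵥ (N⁻¹ *ᵥ f))))) *
      gaussNorm N) = gaussNorm N * (Real.exp (-(1 / 2) * (a * ψ ^ 2)) *
        Real.exp (1 / 2 * (a * ψ * (a * ψ * (f ⬝ᵥ (N⁻¹ *ᵥ f)))))) := by ring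
  rw [e, ← Real.exp_add]
  congr 2
  ring

/-- The matrix determinant lemma for the rank-one update: `det(M + a f fᵀ) = det M·(1 + a⟨f,M⁻¹f⟩)` (the
constants `(det A)^{−1/2}` of (4.20) against the `const` of (4.16)). [cite: Balaban1983RegularityDecay, (4.20) p.592] -/
theorem det_add_rankOne {M : Matrix n n ℝ} (hdet : IsUnit M.det) (a : ℝ) (f : n → ℝ) :
    (M + a • vecMulVec f f).det = M.det * (1 + a * (f ⬝ᵥ (M⁻¹ *ᵥ f))) := by
  have h := det_add_replicateCol_mul_replicateRow (ι := Unit) hdet (a • f) f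
  have e1 : replicateCol Unit (a • f) * replicateRow Unit f = a • vecMulVec f f := by
    rw [← smul_vecMulVec, vecMulVec_eq Unit]
  rw [e1] at h
  rw [h]
  congr 1
  rw [det_unique, Matrix.add_apply, one_apply_eq, Matrix.mul_assoc, ← replicateCol_mulVec,
    replicateRow_mul_replicateCol_apply, mulVec_smul, dotProduct_smul, smul_eq_mul]

/-- The constant of (4.16) against that of `M`: `∫dφ e^{−½φ⬝(M + a f fᵀ)φ} = [∫dφ e^{−½φ⬝Mφ}]/√(1 + a⟨f,M⁻¹f⟩)`
(the matrix determinant lemma inside `gaussNorm = √(2π)^{|n|}/√det`). [cite: Balaban1983RegularityDecay, (4.16), (4.20) p.592] -/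
theorem gaussNorm_add_rankOne {M : Matrix n n ℝ} (hM : M.PosDef) {a : ℝ} (ha : 0 ≤ a) (f : n → ℝ) :
    gaussNorm (M + a • vecMulVec f f) = gaussNorm M / Real.sqrt (1 + a * (f ⬝ᵥ (M⁻¹ *ᵥ f))) := by
  have hdet : IsUnit M.det := isUnit_iff_ne_zero.2 hM.det_pos.ne'
  rw [gaussNorm_eq (rankOne_posDef hM ha f), gaussNorm_eq hM, det_add_rankOne hdet,
    Real.sqrt_mul hM.det_pos.le, div_div]

/-! ## §4. (4.20): the Fourier transform in `ψ` of the left side of (4.16) — all three members agree -/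

/-- The arithmetic of the constants in (4.20): with `A₀⁻¹ = a⁻¹ + s`,
`[√(2π)^N/(√D·√(1+as))]·√(2πA₀⁻¹)·e^{−½A₀⁻¹ξ²} = √(2πa⁻¹)e^{−½a⁻¹ξ²}·[√(2π)^N/√D]·e^{−½sξ²}`. [folklore] -/
private theorem const_identity {a s D P ξ : ℝ} (ha : 0 < a) (hs : 0 ≤ s) (hD : 0 < D) :
    P / Real.sqrt D / Real.sqrt (1 + a * s) *
        (Real.sqrt (2 * Real.pi * (a⁻¹ + s)⁻¹⁻¹) * Real.exp (-(1 / 2) * (a⁻¹ + s)⁻¹⁻¹ * ξ ^ 2))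
      = Real.sqrt (2 * Real.pi * a⁻¹) * Real.exp (-(1 / 2) * a⁻¹ * ξ ^ 2) * (P / Real.sqrt D) *
        Real.exp (-(1 / 2) * s * ξ ^ 2) := by
  rw [inv_inv]
  have h1 : 0 < 1 + a * s := by nlinarith [mul_nonneg ha.le hs]
  have e1 : Real.sqrt (2 * Real.pi * (a⁻¹ + s)) = Real.sqrt (2 * Real.pi * a⁻¹) * Real.sqrt (1 + a * s) := by
    rw [← Real.sqrt_mul (by positivity)]
    congr 1
    field_simp
  have e2 : Real.exp (-(1 / 2) * (a⁻¹ + s) * ξ ^ 2)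
      = Real.exp (-(1 / 2) * a⁻¹ * ξ ^ 2) * Real.exp (-(1 / 2) * s * ξ ^ 2) := by
    rw [← Real.exp_add]; congr 1; ring
  rw [e1, e2]
  have h2 : Real.sqrt (1 + a * s) ≠ 0 := (Real.sqrt_pos.2 h1).ne'
  have h3 : Real.sqrt D ≠ 0 := (Real.sqrt_pos.2 hD).ne'
  field_simp

/-- **(4.20), first member = last member**: the Fourier transform in `ψ` of the left side of (4.16),
*"∫dψ exp(−iξψ)∫dφ exp[−½η^{−1}|ψ + Σ_bη^{d−1}(φ(b₊) − φ(b₋))|² − ½⟨φ,Aφ⟩] = √(2πη)exp(−½ηξ²)(2π)^{L^kd}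
(det A)^{−1/2}exp(−½⟨f,A^{−1}f⟩ξ²)"* (`a = η⁻¹`; `(2π)^{L^kd}(det A)^{−1/2}` = `√(2π)^{|n|}/√(det M)`), obtained here
from (4.16)+(4.21) (`eq416`: the inner integral is `const·e^{−½A₀ψ²}`), (4.17) (`eq417`) and the matrix
determinant lemma (`gaussNorm_add_rankOne`) — i.e. WITHOUT interchanging the two integrations.
[cite: Balaban1983RegularityDecay, (4.20) p.592] -/
theorem eq420 {M : Matrix n n ℝ} (hM : M.PosDef) {a : ℝ} (ha : 0 < a) (f : n → ℝ) (ξ : ℝ) :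
    ∫ ψ : ℝ, cexp (-(I * ξ * ψ)) *
        ((∫ φ : n → ℝ, Real.exp (-(1 / 2) * (a * (ψ + f ⬝ᵥ φ) ^ 2) - 1 / 2 * (φ ⬝ᵥ (M *ᵥ φ))) : ℝ) : ℂ)
      = ((Real.sqrt (2 * Real.pi * a⁻¹) * Real.exp (-(1 / 2) * a⁻¹ * ξ ^ 2) *
          (Real.sqrt (2 * Real.pi) ^ Fintype.card n / Real.sqrt M.det) *
          Real.exp (-(1 / 2) * (f ⬝ᵥ (M⁻¹ *ᵥ f)) * ξ ^ 2) : ℝ) : ℂ) := by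
  simp_rw [eq416 hM ha f]
  have hA := a0_pos hM ha f
  have e1 : ∀ ψ : ℝ, cexp (-(I * ξ * ψ)) *
      (((gaussNorm (M + a • vecMulVec f f) *
        Real.exp (-(1 / 2) * ((a⁻¹ + f ⬝ᵥ (M⁻¹ *ᵥ f))⁻¹ * ψ ^ 2)) : ℝ) : ℂ))
      = (gaussNorm (M + a • vecMulVec f f) : ℂ) *
        (cexp (-(I * ξ * ψ)) * cexp (-(((a⁻¹ + f ⬝ᵥ (M⁻¹ *ᵥ f))⁻¹ / 2 : ℝ) : ℂ) * (ψ : ℂ) ^ 2)) := by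
    intro ψ
    rw [ofReal_mul, ofReal_exp]
    push_cast
    ring_nf
  simp_rw [e1]
  rw [integral_const_mul, eq417 hA ξ, ← ofReal_mul, gaussNorm_add_rankOne hM ha.le f, gaussNorm_eq hM]
  have hs : 0 ≤ f ⬝ᵥ (M⁻¹ *ᵥ f) := by
    simpa only [star_trivial] using hM.posSemidef.inv.dotProduct_mulVec_nonneg f
  congr 1
  exact const_identity ha hs hM.det_pos

/-- **(4.20), middle member = last member**: *"∫dψ exp(−iξψ)exp(−½η^{−1}ψ²)·∫dφ exp iξΣ_bη^{d−1}(φ(b₊) − φ(b₋)) ·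
exp(−½⟨φ,Aφ⟩) = √(2πη)exp(−½ηξ²)(2π)^{L^kd}(det A)^{−1/2}exp(−½⟨f,A^{−1}f⟩ξ²)"* — (4.17) at `A₀ = a = η⁻¹` times the
Gaussian characteristic function `gaussInt_cexp` at `t = ξf`.  With `eq420` all three members of (4.20) agree.
[cite: Balaban1983RegularityDecay, (4.20) p.592] -/
theorem eq420_mid {M : Matrix n n ℝ} (hM : M.PosDef) {a : ℝ} (ha : 0 < a) (f : n → ℝ) (ξ : ℝ) :
    (∫ ψ : ℝ, cexp (-(I * ξ * ψ)) * cexp (-((a / 2 : ℝ) : ℂ) * (ψ : ℂ) ^ 2)) *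
        gaussInt M (fun φ => cexp (I * ξ * ((f ⬝ᵥ φ : ℝ) : ℂ)))
      = ((Real.sqrt (2 * Real.pi * a⁻¹) * Real.exp (-(1 / 2) * a⁻¹ * ξ ^ 2) *
          (Real.sqrt (2 * Real.pi) ^ Fintype.card n / Real.sqrt M.det) *
          Real.exp (-(1 / 2) * (f ⬝ᵥ (M⁻¹ *ᵥ f)) * ξ ^ 2) : ℝ) : ℂ) := by
  have e1 : (fun φ : n → ℝ => cexp (I * ξ * ((f ⬝ᵥ φ : ℝ) : ℂ)))
      = fun φ => cexp (((((ξ • f) ⬝ᵥ φ) : ℝ) : ℂ) * I) := by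
    funext φ
    rw [smul_dotProduct, smul_eq_mul]
    push_cast
    ring_nf
  rw [e1, eq417 ha ξ, gaussInt_cexp hM (ξ • f)]
  have e2 : ((ξ • f) ⬝ᵥ (M⁻¹ *ᵥ (ξ • f)) / 2 : ℝ) = -(-(1 / 2) * (f ⬝ᵥ (M⁻¹ *ᵥ f)) * ξ ^ 2) := by
    rw [mulVec_smul, dotProduct_smul, smul_dotProduct, smul_eq_mul, smul_eq_mul]; ring
  rw [e2, ofReal_neg, neg_neg, ← ofReal_exp, gaussNorm_eq hM]
  push_cast
  ring

end

end Literature.MathematicalPhysics.QuantumFieldTheory.Balaban1983to89.B4Eq417GaussFourier
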